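import Mathlib
import Summits.ResolutionOfSingularities.ResolutionOfSingularities.Theorems.WeightedConstruction.Negative.SatDirTwistedCylinderBk1

/-!
# Twisted arcs of the suspension `Q(N) = S² + v·N(u)²` lie on `N = 0` and never move `S`
(refuter evidence, crux `WeightedConstruction`)

[OURS · L1 W4.3 · refuter res-L1-w43-tri-1 (TRIAGER 1, lens KANGAROO-DISCHARGE), TRIAGE v9.8 §21.16 (B) step (T) ·
supports stmt-ResolutionOfSingularities-0571 · AI-written, weaker than expert review; nothing here is a statement about
resolution of singularities.]

Setting (idea-1 Sketch v6 §12, `Susp.susp`): for `N ∈ k⟦u₁,…,u_m⟧` with `N(0) = 0`, the SUSPENSION is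
`Q(N) := S² + v·N(u)²` in the variables `0 = S`, `1 = v`, `j+2 = u_j` (no characteristic hypothesis is needed here).

* `susp_arc` — if `Q(N)` is twisted-trivial along the arc `γ` in the origin-fixing sense of the tree predicate
  `Theorems.GradedGame.TwistedTrivialAlongFix 2` (any Frobenius exponent), then `N(γ_u) = 0` (the `u`-part of the
  arc is a formal arc ON `N = 0`) and `γ_S = 0` (the direction `S` is never moved).
  Mechanism: by R4-1 `Theorems.GradedGame.xOrderGE_of_twistedTrivialAlongFix` the translate `Q(x + γ(σ))` has
  `x`-order `≥ 2`; its `x`-constant part is `γ_S² + γ_v·N(γ_u)²` and its `x_v`-linear part is `N(γ_u)²`.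

Consequence (prose, TRIAGE v9.8 §21.16 (B)): `S ∉ satDir₂ (Q N)` — the `0 ∉` clause of idea-1's (F1)
`Susp.SatDirExact` — and every twisted arc of `Q(N)` runs inside `{N = 0}`, the input of the hand steps
(F) Frobenius descent, (C) augmented cancellation, (L) lift, which give `satDir₂ (Q N) = {v} ∪ satDir₂ N` over perfect `k`.
-/

set_option linter.dupNamespace false -- mandated namespace of this single-conjunct summit
set_option autoImplicit false

namespace Summit.ResolutionOfSingularities.ResolutionOfSingularities.Theorems.WeightedConstruction.Negative.SuspArcOnN

open MvPowerSeries
open Summit.ResolutionOfSingularities.ResolutionOfSingularities.Theorems.GradedGame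
open Summit.ResolutionOfSingularities.ResolutionOfSingularities.Theorems.WeightedConstruction.Negative.SatDirTwistedCylinderBk1

variable {k : Type} [Field k]

/-! ## Small helpers -/

/-- The lift `u_j ↦ X (j+2)` of `k⟦u⟧` into `k⟦S, v, u⟧` is substitutable. [OURS] -/
theorem hasSubst_liftU (m : ℕ) :
    HasSubst (fun j : Fin m => (X j.succ.succ : MvPowerSeries (Fin (m + 2)) k)) :=
  hasSubst_of_constantCoeff_zero fun j => by simp [constantCoeff_X]

/-- Substituting a family into the lifted `N` substitutes its `u`-part into `N`. [OURS] -/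
theorem subst_liftU {m M : ℕ} (N : MvPowerSeries (Fin m) k) (F : Fin (m + 2) → MvPowerSeries (Fin M) k)
    (hF : HasSubst F) :
    subst F (subst (fun j : Fin m => (X j.succ.succ : MvPowerSeries (Fin (m + 2)) k)) N) =
      subst (fun j : Fin m => F j.succ.succ) N := by
  rw [subst_comp_subst_apply (hasSubst_liftU m) hF]
  congr 1
  funext j
  rw [subst_X hF]

/-- `u_j = X (j+2)` is not the variable `v = X 1`. [OURS] -/
theorem succ_succ_ne_one {m : ℕ} (j : Fin m) : (j.succ.succ : Fin (m + 2)) ≠ 1 := by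
  rw [show (1 : Fin (m + 2)) = (0 : Fin (m + 1)).succ from rfl]
  exact fun h => Fin.succ_ne_zero j (Fin.succ_injective _ h)

/-- A product of two series without constant term has order `≥ 2`. [OURS] -/
theorem orderGE_two_mul {n : ℕ} (φ ψ : MvPowerSeries (Fin n) k) (hφ : constantCoeff φ = 0)
    (hψ : constantCoeff ψ = 0) : OrderGE 2 (φ * ψ) := by
  classical
  intro d hd
  by_contra hlt
  push Not at hlt
  apply hd
  rw [coeff_mul]
  apply Finset.sum_eq_zero
  intro ij hij
  have h := Finset.HasAntidiagonal.mem_antidiagonal.mp hij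
  have hsum : (∑ i : Fin n, ij.1 i) + (∑ i : Fin n, ij.2 i) = ∑ i : Fin n, d i := by
    rw [← Finset.sum_add_distrib]
    exact Finset.sum_congr rfl fun i _ => by rw [← Finsupp.add_apply, h]
  have hz : (∑ i : Fin n, ij.1 i) = 0 ∨ (∑ i : Fin n, ij.2 i) = 0 := by omega
  rcases hz with hz | hz
  · have h1 : ij.1 = 0 := Finsupp.ext fun i =>
      (Finset.sum_eq_zero_iff.mp hz) i (Finset.mem_univ i)
    rw [h1, coeff_zero_eq_constantCoeff_apply, hφ, zero_mul]
  · have h2 : ij.2 = 0 := Finsupp.ext fun i =>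
      (Finset.sum_eq_zero_iff.mp hz) i (Finset.mem_univ i)
    rw [h2, coeff_zero_eq_constantCoeff_apply, hψ, mul_zero]

/-- `OrderGE N` is stable under sums. [OURS] -/
theorem orderGE_add {n : ℕ} (K : ℕ) (φ ψ : MvPowerSeries (Fin n) k) (hφ : OrderGE K φ) (hψ : OrderGE K ψ) :
    OrderGE K (φ + ψ) := by
  intro d hd
  by_contra hlt
  apply hd
  have h1 : coeff d φ = 0 := by
    by_contra h
    exact hlt (hφ d h)
  have h2 : coeff d ψ = 0 := by
    by_contra h
    exact hlt (hψ d h)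
  rw [map_add, h1, h2, add_zero]

/-! ## The theorem -/

/-- **Twisted arcs of the suspension run on `N = 0` and fix `S`.**  If `Q(N) = S² + v·N(u)²` (`0 = S`, `1 = v`,
`j+2 = u_j`; `N(0) = 0`) is twisted-trivial along `γ` (tree predicate, origin-fixing, any exponent), then
`N(γ_u) = 0` in `k⟦σ⟧` and `γ_S = 0`.  [OURS · L1 W4.3 · tri-1 TRIAGE v9.8 §21.16 (B), step (T)] -/
theorem susp_arc {m : ℕ} (N : MvPowerSeries (Fin m) k) (hN : constantCoeff N = 0)
    (γ : Fin (m + 2) → MvPowerSeries (Fin 1) k)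
    (hγ : TwistedTrivialAlongFix 2
      (X 0 ^ 2 + X 1 * (subst (fun j : Fin m => (X j.succ.succ : MvPowerSeries (Fin (m + 2)) k)) N) ^ 2) γ) :
    subst (fun j : Fin m => γ j.succ.succ) N = 0 ∧ γ 0 = 0 := by
  classical
  set L : MvPowerSeries (Fin (m + 2)) k :=
    subst (fun j : Fin m => (X j.succ.succ : MvPowerSeries (Fin (m + 2)) k)) N with hL
  set Q : MvPowerSeries (Fin (m + 2)) k := X 0 ^ 2 + X 1 * L ^ 2 with hQ
  have hγ0 : ∀ i, constantCoeff (γ i) = 0 := hγ.1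
  set γu : Fin m → MvPowerSeries (Fin 1) k := fun j => γ j.succ.succ with hγu
  have hγu0 : ∀ j, constantCoeff (γu j) = 0 := fun j => hγ0 _
  have hγus : HasSubst γu := hasSubst_of_constantCoeff_zero hγu0
  set M₀ : MvPowerSeries (Fin 1) k := subst γu N with hM₀
  -- `Q ∈ 𝔪²`
  have hLc : constantCoeff L = 0 :=
    constantCoeff_subst_eq_zero (hasSubst_liftU m) (fun j => by simp [constantCoeff_X]) hN
  have hO : OrderGE 2 Q := by
    have e : Q = X 0 * X 0 + (X 1 * L) * L := by rw [hQ]; ring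
    rw [e]
    refine orderGE_add 2 _ _ (orderGE_two_mul _ _ (constantCoeff_X 0) (constantCoeff_X 0))
      (orderGE_two_mul _ _ ?_ hLc)
    rw [map_mul, constantCoeff_X, zero_mul]
  -- the translate `Q(x + γ(σ))` has `x`-order ≥ 2 (R4-1)
  have hX := xOrderGE_of_twistedTrivialAlongFix 2 two_ne_zero 2 Q γ hO hγ 0
  have hcoef : ∀ μ : Fin (m + 2 + 1) →₀ ℕ, (∑ i : Fin (m + 2), μ i.succ) < 2 →
      coeff μ (translateAlong 2 0 Q γ) = 0 := by
    intro μ hμ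
    by_contra h
    have := hX μ h
    omega
  have ha := hasSubst_sigma (k := k) (m + 2)
  have haS0 : ∀ i, constantCoeff (subst (fun _ : Fin 1 => (X (0 : Fin (m + 2 + 1)) :
      MvPowerSeries (Fin (m + 2 + 1)) k) ^ (2 ^ 0)) (γ i)) = 0 := fun i =>
    constantCoeff_subst_eq_zero ha (fun _ => by simp [constantCoeff_X]) (hγ0 i)
  -- the `u`-part of every keep/kill family below evaluates `L` to `N(γ_u)` embedded in `k⟦σ, x⟧`
  have hM₀e : subst (fun j : Fin m => subst (fun _ : Fin 1 => (X (0 : Fin (m + 2 + 1)) :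
      MvPowerSeries (Fin (m + 2 + 1)) k) ^ (2 ^ 0)) (γu j)) N =
      subst (fun _ : Fin 1 => (X (0 : Fin (m + 2 + 1)) : MvPowerSeries (Fin (m + 2 + 1)) k) ^ (2 ^ 0)) M₀ := by
    rw [hM₀, subst_comp_subst_apply hγus ha]
  -- STEP 0 (kill every `x`-variable): the `x`-constant part `γ_S² + γ_v·N(γ_u)²` vanishes
  have hfam0 : (fun i : Fin (m + 2) => (if (i.succ : Fin (m + 2 + 1)) = 0 then
        (X i.succ : MvPowerSeries (Fin (m + 2 + 1)) k) else 0)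
      + subst (fun _ : Fin 1 => (X (0 : Fin (m + 2 + 1)) : MvPowerSeries (Fin (m + 2 + 1)) k) ^ (2 ^ 0)) (γ i)) =
      fun i : Fin (m + 2) => subst (fun _ : Fin 1 => (X (0 : Fin (m + 2 + 1)) :
        MvPowerSeries (Fin (m + 2 + 1)) k) ^ (2 ^ 0)) (γ i) := by
    funext i
    rw [if_neg (Fin.succ_ne_zero i), zero_add]
  have hT0 : HasSubst (fun i : Fin (m + 2) => subst (fun _ : Fin 1 => (X (0 : Fin (m + 2 + 1)) :
      MvPowerSeries (Fin (m + 2 + 1)) k) ^ (2 ^ 0)) (γ i)) := hasSubst_of_constantCoeff_zero haS0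
  have hL0 : subst (fun i : Fin (m + 2) => subst (fun _ : Fin 1 => (X (0 : Fin (m + 2 + 1)) :
      MvPowerSeries (Fin (m + 2 + 1)) k) ^ (2 ^ 0)) (γ i)) L =
      subst (fun _ : Fin 1 => (X (0 : Fin (m + 2 + 1)) : MvPowerSeries (Fin (m + 2 + 1)) k) ^ (2 ^ 0)) M₀ := by
    rw [hL, subst_liftU N _ hT0]
    exact hM₀e
  have hE0 : subst (fun v : Fin (m + 2 + 1) => if v = 0 then (X v : MvPowerSeries (Fin (m + 2 + 1)) k) else 0)
        (translateAlong 2 0 Q γ) =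
      subst (fun _ : Fin 1 => (X (0 : Fin (m + 2 + 1)) : MvPowerSeries (Fin (m + 2 + 1)) k) ^ (2 ^ 0))
        (γ 0 ^ 2 + γ 1 * M₀ ^ 2) := by
    rw [subst_keep_translateAlong (fun v : Fin (m + 2 + 1) => v = 0) rfl γ hγ0 Q, hfam0, hQ,
      ← coe_substAlgHom hT0]
    simp only [map_add, map_mul, map_pow]
    rw [substAlgHom_X, substAlgHom_X, coe_substAlgHom hT0, hL0]
    conv_rhs => rw [← coe_substAlgHom ha]; simp only [map_add, map_mul, map_pow]
    rw [coe_substAlgHom ha]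
  have hq0 : γ 0 ^ 2 + γ 1 * M₀ ^ 2 = 0 := by
    apply eq_zero_of_coeff_single
    intro d
    rw [← coeff_single_subst_sigma (N := m + 2), ← hE0,
      coeff_subst_keep _ _ _ (fun v hv => by
        by_contra h
        exact hv (by rw [Finsupp.single_apply, if_neg (Ne.symm h)])),
      hcoef _ (by simp only [single_zero_apply_succ, Finset.sum_const_zero]; norm_num)]
  have hq0' : subst (fun _ : Fin 1 => (X (0 : Fin (m + 2 + 1)) : MvPowerSeries (Fin (m + 2 + 1)) k) ^ (2 ^ 0))
      (γ 0 ^ 2 + γ 1 * M₀ ^ 2) = 0 := by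
    rw [hq0, ← coe_substAlgHom ha, map_zero]
  -- STEP v (keep `σ` and `x_v = X (succ 1)`): the `x_v`-linear part `N(γ_u)²` of the translate vanishes
  have hfamv : (fun i : Fin (m + 2) => (if ((i.succ : Fin (m + 2 + 1)) = 0 ∨ (i.succ : Fin (m + 2 + 1)) = Fin.succ 1)
        then (X i.succ : MvPowerSeries (Fin (m + 2 + 1)) k) else 0)
      + subst (fun _ : Fin 1 => (X (0 : Fin (m + 2 + 1)) : MvPowerSeries (Fin (m + 2 + 1)) k) ^ (2 ^ 0)) (γ i)) =
      fun i : Fin (m + 2) => (if i = 1 then (X i.succ : MvPowerSeries (Fin (m + 2 + 1)) k) else 0)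
        + subst (fun _ : Fin 1 => (X (0 : Fin (m + 2 + 1)) : MvPowerSeries (Fin (m + 2 + 1)) k) ^ (2 ^ 0)) (γ i) := by
    funext i
    by_cases hi : i = 1
    · subst hi; simp
    · rw [if_neg, if_neg hi]
      rintro (h | h)
      · exact Fin.succ_ne_zero _ h
      · exact hi (Fin.succ_injective _ h)
  have hTv : HasSubst (fun i : Fin (m + 2) => (if i = 1 then (X i.succ : MvPowerSeries (Fin (m + 2 + 1)) k) else 0)
      + subst (fun _ : Fin 1 => (X (0 : Fin (m + 2 + 1)) : MvPowerSeries (Fin (m + 2 + 1)) k) ^ (2 ^ 0)) (γ i)) :=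
    hasSubst_of_constantCoeff_zero fun i => by
      rw [map_add, haS0 i, add_zero]
      split_ifs <;> simp [constantCoeff_X]
  have hLv : subst (fun i : Fin (m + 2) => (if i = 1 then (X i.succ : MvPowerSeries (Fin (m + 2 + 1)) k) else 0)
      + subst (fun _ : Fin 1 => (X (0 : Fin (m + 2 + 1)) : MvPowerSeries (Fin (m + 2 + 1)) k) ^ (2 ^ 0)) (γ i)) L =
      subst (fun _ : Fin 1 => (X (0 : Fin (m + 2 + 1)) : MvPowerSeries (Fin (m + 2 + 1)) k) ^ (2 ^ 0)) M₀ := by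
    rw [hL, subst_liftU N _ hTv]
    have e : (fun j : Fin m => (if (j.succ.succ : Fin (m + 2)) = 1 then
          (X (j.succ.succ : Fin (m + 2)).succ : MvPowerSeries (Fin (m + 2 + 1)) k) else 0)
        + subst (fun _ : Fin 1 => (X (0 : Fin (m + 2 + 1)) : MvPowerSeries (Fin (m + 2 + 1)) k) ^ (2 ^ 0))
          (γ j.succ.succ)) =
        fun j : Fin m => subst (fun _ : Fin 1 => (X (0 : Fin (m + 2 + 1)) :
          MvPowerSeries (Fin (m + 2 + 1)) k) ^ (2 ^ 0)) (γu j) := by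
      funext j
      rw [if_neg (succ_succ_ne_one j), zero_add]
    rw [e]
    exact hM₀e
  have hEv : subst (fun v : Fin (m + 2 + 1) => if (v = 0 ∨ v = Fin.succ 1) then
        (X v : MvPowerSeries (Fin (m + 2 + 1)) k) else 0) (translateAlong 2 0 Q γ) =
      X (Fin.succ 1) * subst (fun _ : Fin 1 => (X (0 : Fin (m + 2 + 1)) : MvPowerSeries (Fin (m + 2 + 1)) k) ^ (2 ^ 0))
          (M₀ ^ 2)
      + subst (fun _ : Fin 1 => (X (0 : Fin (m + 2 + 1)) : MvPowerSeries (Fin (m + 2 + 1)) k) ^ (2 ^ 0))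
          (γ 0 ^ 2 + γ 1 * M₀ ^ 2) := by
    rw [subst_keep_translateAlong (fun v : Fin (m + 2 + 1) => v = 0 ∨ v = Fin.succ 1) (Or.inl rfl) γ hγ0 Q, hfamv,
      hQ, ← coe_substAlgHom hTv]
    simp only [map_add, map_mul, map_pow]
    rw [substAlgHom_X, substAlgHom_X, coe_substAlgHom hTv, hLv]
    rw [if_neg (show ¬((0 : Fin (m + 2)) = 1) from Fin.zero_ne_one), if_pos rfl, zero_add]
    conv_rhs => rw [← coe_substAlgHom ha]; simp only [map_add, map_mul, map_pow]
    rw [coe_substAlgHom ha]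
    ring
  have hrv : M₀ ^ 2 = 0 := by
    apply eq_zero_of_coeff_single
    intro d
    have hc := hcoef (Finsupp.single 0 d + Finsupp.single (Fin.succ 1) 1) (by
      simp only [Finsupp.add_apply, single_zero_apply_succ, single_succ_apply_succ, zero_add, Finset.sum_ite_eq,
        Finset.mem_univ, if_true]
      norm_num)
    rw [← coeff_subst_keep (fun v : Fin (m + 2 + 1) => v = 0 ∨ v = Fin.succ 1) _ _ (fun v hv => by
        by_contra h
        push Not at h
        apply hv
        rw [Finsupp.add_apply, Finsupp.single_apply, if_neg (Ne.symm h.1), Finsupp.single_apply,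
          if_neg (Ne.symm h.2), add_zero]),
      hEv, hq0', add_zero, coeff_single_add_X_mul, coeff_single_subst_sigma (N := m + 2)] at hc
    exact hc
  -- CONCLUSION in `k⟦σ⟧` (no zero divisors)
  have hM : M₀ = 0 := (pow_eq_zero_iff two_ne_zero).mp hrv
  refine ⟨hM, ?_⟩
  have e : γ 0 ^ 2 = 0 := by
    rw [hM] at hq0
    linear_combination hq0
  exact (pow_eq_zero_iff two_ne_zero).mp e

/-- Corollary: the direction `S` is never moved by a twisted arc of `Q(N)` — `S ∉ satDir₂ (Q N)` in idea-1's
vocabulary (the `0 ∉` clause of `Susp.SatDirExact`). [OURS · L1 W4.3] -/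
theorem susp_arc_S_eq_zero {m : ℕ} (N : MvPowerSeries (Fin m) k) (hN : constantCoeff N = 0)
    (γ : Fin (m + 2) → MvPowerSeries (Fin 1) k)
    (hγ : TwistedTrivialAlongFix 2
      (X 0 ^ 2 + X 1 * (subst (fun j : Fin m => (X j.succ.succ : MvPowerSeries (Fin (m + 2)) k)) N) ^ 2) γ) :
    γ 0 = 0 :=
  (susp_arc N hN γ hγ).2

/-- Corollary: the `u`-part of a twisted arc of `Q(N)` is a formal arc on `N = 0`. [OURS · L1 W4.3] -/
theorem susp_arc_eval_eq_zero {m : ℕ} (N : MvPowerSeries (Fin m) k) (hN : constantCoeff N = 0)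
    (γ : Fin (m + 2) → MvPowerSeries (Fin 1) k)
    (hγ : TwistedTrivialAlongFix 2
      (X 0 ^ 2 + X 1 * (subst (fun j : Fin m => (X j.succ.succ : MvPowerSeries (Fin (m + 2)) k)) N) ^ 2) γ) :
    subst (fun j : Fin m => γ j.succ.succ) N = 0 :=
  (susp_arc N hN γ hγ).1

end Summit.ResolutionOfSingularities.ResolutionOfSingularities.Theorems.WeightedConstruction.Negative.SuspArcOnN
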